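import Literature.MathematicalPhysics.QuantumLattice.HubbardEffectiveActionCT
import Literature.Analysis.SpecialFunctions.MatsubaraSum

/-!
# Crux `CapRgSymmetricCertificatePinned` (item `stmt-HubbardSuperconductivity-14045`, route
# `AposterioriCapRg`): the symmetric Matsubara tadpole of the tree's free CT propagator is the MIDPOINT
# `β(½ - n_F(e_K))`

Negative-side support lemmas (lead c7, 2026-08-17): the kernel-checked computational core of the FRAME
finding M1 of refuter rattack-14045 / lead c6 (`Cruxes/CapRgSymmetricCertificatePinned/VERDICT-c6.md` §1):
conjunct 1 of the crux reads the OPERATOR model `hubbardTorusWith 2 (L+1) 1 U μ`, conjunct 2 the Grassmann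
object `hubbardEffectiveActionCT L M β U μ 0 K Λ`, whose covariance is the free CT propagator
`(nambuPropagatorCT L M β μ 0 K (ω, k⃗))₀₀ = 1/(-iω + e_K(k⃗))` (`nambuPropagatorCT_zero_seed`) on the tree's
SYMMETRIC frequency set `MatsubaraIdx M`, `n ∈ [-M, M)` (`matsubaraFreq_rev : ω_{rev i} = -ω_i`).  Every
equal-argument contraction ("tadpole") of that object along the certificate's own limit `M → ∞` is the
symmetric frequency sum computed here:

* §1 `sum_matsubaraFreq_div_sq_add_sq_eq_zero`, `sum_one_div_neg_I_mul_matsubaraFreq_add` — at every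
  finite `M` the sum `Σ_{i : MatsubaraIdx M} 1/(-iω_i + ξ)` is REAL and equals `Σ_i ξ/(ω_i² + ξ²)` (the odd
  part cancels under `i ↦ rev i`);
* §2 `sum_matsubaraIdx_eq_sum_range_add`, `tendsto_sum_matsubara_div_sq_add_sq` — as `M → ∞` it converges to
  `β tanh(βξ/2)/2` (both halves of the tree's two-sided Matsubara sum
  `Literature.Analysis.SpecialFunctions.tsum_one_div_matsubara_sq_add_sq`), for EVERY `ξ` (`ξ = 0`: both
  sides vanish);
* §3 `tanh_half_div_two_eq`, `tendsto_sum_nambuPropagatorCT_zero_seed`,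
  `tendsto_inv_mul_sum_nambuPropagatorCT_zero_seed` — hence
  `(1/β) Σ_{i : MatsubaraIdx M} (nambuPropagatorCT L M β μ 0 K (i, k⃗))₀₀ → ½ - n_F(e_K(k⃗))`,
  `n_F(e) = (1 + e^{βe})⁻¹`: the MIDPOINT of the equal-time jump of the free two-point function, not the
  operator-ordered value `-n_F` (`τ → 0⁻`) or `1 - n_F` (`τ → 0⁺`).  Consequently the first-order (Hartree)
  shift produced by the tree's quartic `V = U ∫ ψ⁺↑ψ⁻↑ψ⁺↓ψ⁻↓` (`hubbardInteraction`) under this convention is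
  `U(n_{-σ} - ½)`, i.e. that of the operator `U(n↑ - ½)(n↓ - ½) = U n↑n↓ - (U/2)N + U/4`: the Grassmann
  objects at chemical potential `μ` sit at operator chemical potential `μ + U/2` (the repair `C′` of
  rattack-14045 reads the certificate at `μ - U/2`).  Nothing here asserts or refutes a Theses decl; no
  functional-integral identity is claimed (the tree has none, `HubbardEffectiveActionCT` §Design choices) —
  these are the frequency sums any such identity must evaluate.

Sources: A. L. Fetter, J. D. Walecka, *Quantum Theory of Many-Particle Systems* (1971), §25 (frequency sums and
the convergence factor `e^{iω_n η}`); G. Benfatto, A. Giuliani, V. Mastropietro, Ann. Henri Poincaré 7 (2006)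
§2.1 (2.2)–(2.6) [`BenfattoGiulianiMastropietro2006`]; the tree's `MatsubaraSum.lean`. [folklore]
-/

noncomputable section

namespace Summit.HubbardSuperconductivity.CapRgSymmetricCertificatePinned.Negative

open Literature.MathematicalPhysics.QuantumLattice Literature.Probability.LatticeModels
open Literature.Analysis.SpecialFunctions Finset Filter
open scoped BigOperators Topology Real

/-! ## §1 Finite `M`: the symmetric frequency sum of `1/(-iω + ξ)` is real -/

section Finite

variable {M : ℕ}

/-- **The odd part cancels**: `Σ_{i : MatsubaraIdx M} ω_i/(ω_i² + ξ²) = 0`, the frequency set being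
symmetric under `i ↦ rev i` (`ω_{rev i} = -ω_i`). [folklore] -/
theorem sum_matsubaraFreq_div_sq_add_sq_eq_zero (β ξ : ℝ) :
    ∑ i : MatsubaraIdx M, matsubaraFreq β M i / (matsubaraFreq β M i ^ 2 + ξ ^ 2) = 0 := by
  set g : MatsubaraIdx M → ℝ := fun i => matsubaraFreq β M i / (matsubaraFreq β M i ^ 2 + ξ ^ 2) with hg
  have hrev : ∀ i, g (Fin.rev i) = -g i := fun i => by
    simp only [hg, matsubaraFreq_rev, neg_sq, neg_div]
  have hsum : ∑ i, g i = ∑ i, g (Fin.revPerm i) := (Equiv.sum_comp Fin.revPerm g).symm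
  have h2 : ∑ i, g i = -∑ i, g i := by
    conv_lhs => rw [hsum]
    rw [← Finset.sum_neg_distrib]
    exact Finset.sum_congr rfl fun i _ => hrev i
  linarith

/-- The summand: `1/(-iω + ξ) = iω/(ω² + ξ²) + ξ/(ω² + ξ²)` for a NON-ZERO frequency `ω`. [folklore] -/
theorem one_div_neg_I_mul_add_eq {ω : ℝ} (hω : ω ≠ 0) (ξ : ℝ) :
    (1 : ℂ) / (-Complex.I * ω + ξ) =
      Complex.I * ((ω / (ω ^ 2 + ξ ^ 2) : ℝ) : ℂ) + ((ξ / (ω ^ 2 + ξ ^ 2) : ℝ) : ℂ) := by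
  have hpos : (0 : ℝ) < ω ^ 2 + ξ ^ 2 := by positivity
  have hne : ((ω ^ 2 + ξ ^ 2 : ℝ) : ℂ) ≠ 0 := by exact_mod_cast hpos.ne'
  have hden : (-Complex.I * ω + ξ : ℂ) ≠ 0 := by
    intro h
    have := congrArg Complex.im h
    simp at this
    exact hω this
  have hne' : ((ω : ℂ) ^ 2 + (ξ : ℂ) ^ 2) ≠ 0 := by exact_mod_cast hpos.ne'
  rw [div_eq_iff hden]
  push_cast
  rw [mul_div_assoc', ← add_div, div_mul_eq_mul_div, eq_div_iff hne']
  ring_nf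
  rw [Complex.I_sq]
  ring

/-- **At every finite `M` the symmetric frequency sum of the free propagator is real**:
`Σ_{i : MatsubaraIdx M} 1/(-iω_i + ξ) = Σ_i ξ/(ω_i² + ξ²)` (`β ≠ 0`; the odd part
`i Σ ω_i/(ω_i² + ξ²)` cancels). [folklore] -/
theorem sum_one_div_neg_I_mul_matsubaraFreq_add {β : ℝ} (hβ : β ≠ 0) (ξ : ℝ) :
    ∑ i : MatsubaraIdx M, (1 : ℂ) / (-Complex.I * matsubaraFreq β M i + ξ) =
      ((∑ i : MatsubaraIdx M, ξ / (matsubaraFreq β M i ^ 2 + ξ ^ 2) : ℝ) : ℂ) := by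
  have hterm : ∀ i : MatsubaraIdx M, (1 : ℂ) / (-Complex.I * matsubaraFreq β M i + ξ) =
      Complex.I * ((matsubaraFreq β M i / (matsubaraFreq β M i ^ 2 + ξ ^ 2) : ℝ) : ℂ) +
        ((ξ / (matsubaraFreq β M i ^ 2 + ξ ^ 2) : ℝ) : ℂ) :=
    fun i => one_div_neg_I_mul_add_eq (matsubaraFreq_ne_zero hβ i) ξ
  rw [Finset.sum_congr rfl fun i _ => hterm i, Finset.sum_add_distrib, ← Finset.mul_sum,
    ← Complex.ofReal_sum, ← Complex.ofReal_sum, sum_matsubaraFreq_div_sq_add_sq_eq_zero]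
  simp

end Finite

/-! ## §2 The limit `M → ∞`: both halves of the two-sided Matsubara sum -/

section Limit

/-- **Re-indexing the symmetric frequency set**: a sum over `MatsubaraIdx M` (`n = i - M ∈ [-M, M)`) is the
sum over `n = 0, …, M-1` plus the sum over `n = -1, …, -M`. [folklore] -/
theorem sum_matsubaraIdx_eq_sum_range_add {α : Type*} [AddCommMonoid α] (M : ℕ) (G : ℤ → α) :
    ∑ i : MatsubaraIdx M, G (matsubaraInt M i) =
      ∑ m ∈ Finset.range M, G m + ∑ m ∈ Finset.range M, G (-((m : ℤ) + 1)) := by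
  unfold matsubaraInt
  rw [Fin.sum_univ_eq_sum_range (fun j : ℕ => G ((j : ℤ) - (M : ℕ))) (2 * M), two_mul,
    Finset.sum_range_add, add_comm]
  congr 1
  · refine Finset.sum_congr rfl fun m _ => ?_
    congr 1
    push_cast
    ring
  · rw [← Finset.sum_range_reflect (fun j : ℕ => G ((j : ℤ) - (M : ℕ))) M]
    refine Finset.sum_congr rfl fun m hm => ?_
    have hm' : m < M := Finset.mem_range.1 hm
    congr 1
    rw [Nat.cast_sub (by omega : m ≤ M - 1), Nat.cast_sub (by omega : 1 ≤ M)]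
    push_cast
    ring

/-- **The symmetric Matsubara tadpole sum converges to `β tanh(βξ/2)/2`**:
`Σ_{i : MatsubaraIdx M} ξ/(ω_i² + ξ²) → β tanh(βξ/2)/2` as `M → ∞` (`β > 0`, every `ξ`; for `ξ ≠ 0` the two
halves `n ≥ 0` and `n < 0` each tend to `β tanh(βξ/2)/(4ξ)` by the tree's Matsubara sum, for `ξ = 0` both
sides vanish). [cite: BenfattoGiulianiMastropietro2006, §2.1 (2.2)-(2.5)] -/
theorem tendsto_sum_matsubara_div_sq_add_sq {β : ℝ} (hβ : 0 < β) (ξ : ℝ) :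
    Tendsto (fun M : ℕ => ∑ i : MatsubaraIdx M, ξ / (matsubaraFreq β M i ^ 2 + ξ ^ 2)) atTop
      (𝓝 (β * Real.tanh (β * ξ / 2) / 2)) := by
  rcases eq_or_ne ξ 0 with rfl | hξ
  · simp only [zero_div, Finset.sum_const_zero, mul_zero, Real.tanh_zero]
    exact tendsto_const_nhds
  -- the summand as a function of the integer label
  set f : ℤ → ℝ := fun n => 1 / ((Real.pi * (2 * (n : ℝ) + 1) / β) ^ 2 + ξ ^ 2) with hf
  have hsum : ∀ M : ℕ, ∑ i : MatsubaraIdx M, ξ / (matsubaraFreq β M i ^ 2 + ξ ^ 2) =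
      ξ * (∑ m ∈ Finset.range M, f m + ∑ m ∈ Finset.range M, f (-((m : ℤ) + 1))) := by
    intro M
    rw [← sum_matsubaraIdx_eq_sum_range_add M f, Finset.mul_sum]
    refine Finset.sum_congr rfl fun i _ => ?_
    rw [hf, matsubaraFreq]
    ring
  -- the one-sided Matsubara sum of the tree, in the present normalisation of the frequencies
  have h0 : HasSum (fun n : ℕ => 1 / (((2 * n + 1) * Real.pi / β) ^ 2 + ξ ^ 2))
      (β * Real.tanh (β * ξ / 2) / (4 * ξ)) := by
    rw [← tsum_one_div_matsubara_sq_add_sq hβ hξ]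
    exact (summable_one_div_matsubara_sq_add_sq hβ ξ).hasSum
  have h1 : HasSum (fun m : ℕ => f m) (β * Real.tanh (β * ξ / 2) / (4 * ξ)) := by
    convert h0 using 1
    funext m
    rw [hf]
    push_cast
    ring_nf
  have h2 : HasSum (fun m : ℕ => f (-((m : ℤ) + 1))) (β * Real.tanh (β * ξ / 2) / (4 * ξ)) := by
    convert h0 using 1
    funext m
    rw [hf]
    push_cast
    ring_nf
  have hlim := (h1.tendsto_sum_nat.add h2.tendsto_sum_nat).const_mul ξ
  have hval : ξ * (β * Real.tanh (β * ξ / 2) / (4 * ξ) + β * Real.tanh (β * ξ / 2) / (4 * ξ)) =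
      β * Real.tanh (β * ξ / 2) / 2 := by
    field_simp
    ring
  rw [← hval]
  refine hlim.congr' (Eventually.of_forall fun M => (hsum M).symm)

end Limit

/-! ## §3 Model form: the symmetric tadpole of the free CT propagator is the midpoint `½ - n_F(e_K)` -/

section Model

/-- `tanh(x/2)/2 = ½ - (1 + eˣ)⁻¹`: half the hyperbolic tangent is one half minus the Fermi function.
[folklore] -/
theorem tanh_half_div_two_eq (x : ℝ) : Real.tanh (x / 2) / 2 = 1 / 2 - (1 + Real.exp x)⁻¹ := by
  rw [tanh_half_eq]
  have hpos : 0 < Real.exp x + 1 := by positivity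
  field_simp
  ring

variable {L : ℕ}

/-- **The symmetric frequency sum of the tree's free CT propagator** at zero seed:
`Σ_{i : MatsubaraIdx M} (nambuPropagatorCT L M β μ 0 K (i, k⃗))₀₀ = Σ_i e_K(k⃗)/(ω_i² + e_K(k⃗)²)` — a REAL
number at every finite `M` (`β ≠ 0`). [cite: BenfattoGiulianiMastropietro2003, §1.2 The model (2.6)] -/
theorem sum_nambuPropagatorCT_zero_seed {β : ℝ} (hβ : β ≠ 0) (μ : ℝ) (K : TrigPolyC4v) (M : ℕ)
    (k : TorusSite 2 L) :
    ∑ i : MatsubaraIdx M, nambuPropagatorCT L M β μ 0 K (i, k) 0 0 =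
      ((∑ i : MatsubaraIdx M,
          nambuXiCT L μ K k / (matsubaraFreq β M i ^ 2 + nambuXiCT L μ K k ^ 2) : ℝ) : ℂ) := by
  rw [← sum_one_div_neg_I_mul_matsubaraFreq_add hβ]
  exact Finset.sum_congr rfl fun i _ => nambuPropagatorCT_zero_seed L M hβ μ K (i, k)

/-- **The symmetric Matsubara tadpole of the free CT propagator converges to `β tanh(β e_K/2)/2`**:
`Σ_{i : MatsubaraIdx M} (nambuPropagatorCT L M β μ 0 K (i, k⃗))₀₀ → β tanh(β e_K(k⃗)/2)/2` as `M → ∞`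
(`β > 0`, every frame `K`, chemical potential `μ` and momentum `k⃗`). [folklore] -/
theorem tendsto_sum_nambuPropagatorCT_zero_seed {β : ℝ} (hβ : 0 < β) (μ : ℝ) (K : TrigPolyC4v)
    (k : TorusSite 2 L) :
    Tendsto (fun M : ℕ => ∑ i : MatsubaraIdx M, nambuPropagatorCT L M β μ 0 K (i, k) 0 0) atTop
      (𝓝 ((β * Real.tanh (β * nambuXiCT L μ K k / 2) / 2 : ℝ) : ℂ)) := by
  have h := (Complex.continuous_ofReal.tendsto _).comp
    (tendsto_sum_matsubara_div_sq_add_sq hβ (nambuXiCT L μ K k))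
  refine h.congr' (Eventually.of_forall fun M => ?_)
  simp only [Function.comp_apply]
  exact (sum_nambuPropagatorCT_zero_seed hβ.ne' μ K M k).symm

/-- **The symmetric tadpole is the MIDPOINT `½ - n_F(e_K)`**: along the certificate's own limit `M → ∞`,
`(1/β) Σ_{i : MatsubaraIdx M} (nambuPropagatorCT L M β μ 0 K (i, k⃗))₀₀ → ½ - (1 + e^{β e_K(k⃗)})⁻¹` — neither
the operator-ordered `-n_F(e_K)` (`τ → 0⁻`) nor `1 - n_F(e_K)` (`τ → 0⁺`) but their mean; with this
convention the Hartree shift of the quartic `U ∫ψ⁺↑ψ⁻↑ψ⁺↓ψ⁻↓` is `U(n_{-σ} - ½)`, that of the operator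
`U(n↑ - ½)(n↓ - ½)`, i.e. operator chemical potential `μ + U/2`. [folklore] -/
theorem tendsto_inv_mul_sum_nambuPropagatorCT_zero_seed {β : ℝ} (hβ : 0 < β) (μ : ℝ) (K : TrigPolyC4v)
    (k : TorusSite 2 L) :
    Tendsto (fun M : ℕ => ((1 / β : ℝ) : ℂ) * ∑ i : MatsubaraIdx M, nambuPropagatorCT L M β μ 0 K (i, k) 0 0)
      atTop (𝓝 ((1 / 2 - (1 + Real.exp (β * nambuXiCT L μ K k))⁻¹ : ℝ) : ℂ)) := by
  have h := (tendsto_sum_nambuPropagatorCT_zero_seed hβ μ K k).const_mul ((1 / β : ℝ) : ℂ)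
  convert h using 2
  rw [← Complex.ofReal_mul, ← tanh_half_div_two_eq, mul_div_assoc]
  congr 1
  field_simp

end Model

end Summit.HubbardSuperconductivity.CapRgSymmetricCertificatePinned.Negative

end
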